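import Summits.AnomalousDissipation.AnomalousDissipation.Theorems.SawtoothPulseCascadeK1LocalisedCascadeVFibreTube
import Summits.AnomalousDissipation.AnomalousDissipation.Theorems.SawtoothPulseCascadeK1LocalisedCascadeChirpWindowMass

/-!
# K1loc explicit start, phase 1: THE V-FIBRE WINDOW BOUND SPLIT BY RESIDUE CLASSES («VFibreParity»)

Helper file of the prover lane on the crux `K1LocalisedCascade` (stmt-AnomalousDissipation-19491), route `SawtoothPulseCascade`
(arbiter A24-6 steps (3)–(5): `j_V + j_O`).  The exact two-tooth chirp of lobe `8n` has `ĝ₀(m) = 0` unless `m ≡ 2 (mod 4)` or `m = ±8n`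
(`…ChirpWindowMass.norm_fourierCoeff_twoTooth_le`).  Hence on a V-fibre window `W` whose distance to the sources stays below `8|n|`, the
finite convolution `Σ_{p∈S} c_p ĝ₀(m−p)` only sees ONE residue class `p mod 4` for each `m`, and the window energy splits:
`Σ_{m∈W} ‖Σ_{p∈S} c_p ĝ₀(m−p)‖² = Σ_{r<4} Σ_{m∈W} ‖Σ_{p∈S, p≡r} c_p ĝ₀(m−p)‖²` (`sum_window_sq_conv_eq_sum_classes`).  Combined with Minkowski and
the weighted Cauchy–Schwarz of `…VFibreTube` inside each class, the rounding transfer `…CornerTraceRounding.sqrt_window_sq_twist_le` and the `ℓ²`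
contraction on the sources outside `S`:
* **`vfibre_window_sq_parity_le`**: for `a′ = θ ∘ shearMap 1 0 ψ`, weights `u > 0` on `S` and a class-uniform bound
  `Σ_{p∈S, p≡r} u_p·μ₀(p) ≤ Γ` (`μ₀(p) = Σ_{m∈W} ‖ĝ₀(m−p)‖²`, every `r`):
  `Σ_{m∈W} ‖𝓕a′(m,n)‖² ≤ (1+t)·Γ·Σ_{p∈S} ‖𝓕θ(p,n)‖²/u_p + (1+1/t)·[(1+s)·Σ'_{p∉S} ‖𝓕θ(p,n)‖² + (1+1/s)(2πη)²·Σ_{p∈S} ‖𝓕θ(p,n)‖²]`.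
No definitions; nothing about the crux. [cite: Grafakos2014, Prop. 3.1.2 (5), Prop. 3.2.7 (3)] [problem: turb]
-/

-- `Summit.<Summit>.<Problem>`: single-conjunct summit, the duplicate namespace segment is deliberate.
set_option linter.dupNamespace false

noncomputable section

namespace Summit.AnomalousDissipation.AnomalousDissipation.Theorems.SawtoothPulseCascade.K1Window

open MeasureTheory Filter Topology UnitAddTorus Complex AddCircle
open scoped Real
open Literature.Analysis Literature.Analysis.FunctionSpaces Literature.Analysis.FunctionSpaces.Torus Literature.Analysis.FluidPDE
open Literature.Analysis.FluidPDE.ShearStage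
open Literature.Analysis.FluidPDE.SawtoothCascade Literature.Analysis.FluidPDE.SawtoothCascade.CascadeParams

/-! ## §1 Parity of the two-tooth chirp and the class decomposition of a finite convolution -/

/-- **Parity**: the exact two-tooth chirp of lobe `8n` has `ĝ₀(m) = 0` for `m ≢ 2 (mod 4)`, `m ≠ ±8n`. [cite: Grafakos2014, Prop. 3.1.2 (5)] -/
theorem fourierCoeff_twoTooth_eq_zero_of_mod_ne (n : ℤ) {g₀ : UnitAddCircle → ℂ}
    (hg₀ : ∀ t : ℝ, g₀ (t : UnitAddCircle) =
      Complex.exp (-(2 * π * I * ((8 * n : ℤ)) * ((tri (2 * π * (2 : ℕ) * t) / (2 * π * (2 : ℕ)) : ℝ) : ℂ))))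
    {m : ℤ} (hm₁ : 8 * n + m ≠ 0) (hm₂ : 8 * n - m ≠ 0) (hres : ¬ m % 4 = 2) :
    fourierCoeff g₀ m = 0 := by
  have h := norm_fourierCoeff_twoTooth_le n hg₀ hm₁ hm₂
  rw [if_neg hres] at h
  exact norm_eq_zero.1 (le_antisymm h (norm_nonneg _))

/-- **One class per mode**: if every `m − p` (`p ∈ S`) avoids `±8n`, then
`Σ_{p∈S} c_p ĝ₀(m−p) = Σ_{p∈S, p % 4 = (m−2) % 4} c_p ĝ₀(m−p)`. [cite: Grafakos2014, Prop. 3.1.2 (5)] -/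
theorem sum_conv_eq_sum_class (n : ℤ) {g₀ : UnitAddCircle → ℂ}
    (hg₀ : ∀ t : ℝ, g₀ (t : UnitAddCircle) =
      Complex.exp (-(2 * π * I * ((8 * n : ℤ)) * ((tri (2 * π * (2 : ℕ) * t) / (2 * π * (2 : ℕ)) : ℝ) : ℂ))))
    (c : ℤ → ℂ) (S : Finset ℤ) (m : ℤ) (hm : ∀ p ∈ S, 8 * n + (m - p) ≠ 0 ∧ 8 * n - (m - p) ≠ 0) :
    ∑ p ∈ S, c p * fourierCoeff g₀ (m - p) = ∑ p ∈ S.filter (fun p => p % 4 = (m - 2) % 4), c p * fourierCoeff g₀ (m - p) := by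
  rw [Finset.sum_filter]
  refine Finset.sum_congr rfl fun p hp => ?_
  split_ifs with h
  · rfl
  · have hres : ¬ (m - p) % 4 = 2 := by omega
    rw [fourierCoeff_twoTooth_eq_zero_of_mod_ne n hg₀ (hm p hp).1 (hm p hp).2 hres, mul_zero]

/-- **The window energy splits over the four classes**: under the same hypothesis for every `m ∈ W`,
`Σ_{m∈W} ‖Σ_{p∈S} c_p ĝ₀(m−p)‖² = Σ_{r ∈ [0,3]} Σ_{m∈W} ‖Σ_{p∈S, p % 4 = r} c_p ĝ₀(m−p)‖²`. [cite: Grafakos2014, Prop. 3.1.2 (5)] -/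
theorem sum_window_sq_conv_eq_sum_classes (n : ℤ) {g₀ : UnitAddCircle → ℂ}
    (hg₀ : ∀ t : ℝ, g₀ (t : UnitAddCircle) =
      Complex.exp (-(2 * π * I * ((8 * n : ℤ)) * ((tri (2 * π * (2 : ℕ) * t) / (2 * π * (2 : ℕ)) : ℝ) : ℂ))))
    (c : ℤ → ℂ) (S W : Finset ℤ) (hWS : ∀ m ∈ W, ∀ p ∈ S, 8 * n + (m - p) ≠ 0 ∧ 8 * n - (m - p) ≠ 0) :
    ∑ m ∈ W, ‖∑ p ∈ S, c p * fourierCoeff g₀ (m - p)‖ ^ 2 =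
      ∑ r ∈ Finset.Icc (0 : ℤ) 3, ∑ m ∈ W, ‖∑ p ∈ S.filter (fun p => p % 4 = r), c p * fourierCoeff g₀ (m - p)‖ ^ 2 := by
  rw [Finset.sum_comm]
  refine Finset.sum_congr rfl fun m hm => ?_
  -- every class other than `r₀ = (m−2) % 4` contributes zero
  have hcls : ∀ r ∈ Finset.Icc (0 : ℤ) 3, r ≠ (m - 2) % 4 →
      ∑ p ∈ S.filter (fun p => p % 4 = r), c p * fourierCoeff g₀ (m - p) = 0 := by
    intro r _ hr
    refine Finset.sum_eq_zero fun p hp => ?_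
    rw [Finset.mem_filter] at hp
    have hres : ¬ (m - p) % 4 = 2 := by omega
    rw [fourierCoeff_twoTooth_eq_zero_of_mod_ne n hg₀ (hWS m hm p hp.1).1 (hWS m hm p hp.1).2 hres, mul_zero]
  have hr₀ : (m - 2) % 4 ∈ Finset.Icc (0 : ℤ) 3 := by rw [Finset.mem_Icc]; omega
  rw [Finset.sum_eq_single_of_mem ((m - 2) % 4) hr₀ (fun r hr hne => by rw [hcls r hr hne, norm_zero, zero_pow two_ne_zero]),
    sum_conv_eq_sum_class n hg₀ c S m (hWS m hm)]

/-- Regrouping a sum over `S` by the four classes: `Σ_{r∈[0,3]} Σ_{p∈S, p%4=r} f p = Σ_{p∈S} f p`. [folklore] -/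
theorem sum_classes_eq_sum (S : Finset ℤ) (f : ℤ → ℝ) :
    ∑ r ∈ Finset.Icc (0 : ℤ) 3, ∑ p ∈ S.filter (fun p => p % 4 = r), f p = ∑ p ∈ S, f p :=
  Finset.sum_fiberwise_of_maps_to (g := fun p : ℤ => p % 4) (fun p _ => by rw [Finset.mem_Icc]; omega) f

/-! ## §2 The V-fibre window bound split by classes -/

/-- **THE V-FIBRE WINDOW BOUND, SPLIT BY RESIDUE CLASSES**: `θ : 𝕋² → ℂ` continuous with `Σ‖𝓕θ‖ < ∞`, `a′ = θ ∘ shearMap 1 0 ψ`, a fibre `n`,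
`g₀` the exact two-tooth chirp of lobe `8n` with `|nψ − 8n·tri(4πt)/(4π)| ≤ η`, a finite window `W` and source set `S` with `m − p ≠ ±8n`
(`m ∈ W`, `p ∈ S`), weights `u > 0` on `S`, `t, s > 0`, and `Σ_{p∈S, p%4=r} u_p·Σ_{m∈W}‖ĝ₀(m−p)‖² ≤ Γ` for every class `r`:
`Σ_{m∈W} ‖𝓕a′(m,n)‖² ≤ (1+t)·Γ·Σ_{p∈S} ‖𝓕θ(p,n)‖²/u_p + (1+1/t)·((1+s)·Σ'_{p∉S} ‖𝓕θ(p,n)‖² + (1+1/s)·(2πη)²·Σ_{p∈S} ‖𝓕θ(p,n)‖²)`.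
[cite: Grafakos2014, Prop. 3.1.2 (5), Prop. 3.2.7 (3)] -/
theorem vfibre_window_sq_parity_le {θ : UnitAddTorus (Fin 2) → ℂ} (hθ : Continuous θ)
    (hsum : Summable fun k => ‖mFourierCoeff θ k‖) (ψ : ShearProfile) (n : ℤ) {g₀ : UnitAddCircle → ℂ}
    (hg₀ : ∀ t : ℝ, g₀ (t : UnitAddCircle) =
      Complex.exp (-(2 * π * I * ((8 * n : ℤ)) * ((tri (2 * π * (2 : ℕ) * t) / (2 * π * (2 : ℕ)) : ℝ) : ℂ))))
    (hg₀c : Continuous g₀) {η : ℝ} (hη : ∀ t : ℝ, |n * ψ t - ((8 * n : ℤ)) * (tri (2 * π * (2 : ℕ) * t) / (2 * π * (2 : ℕ)))| ≤ η)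
    (S W : Finset ℤ) (hWS : ∀ m ∈ W, ∀ p ∈ S, 8 * n + (m - p) ≠ 0 ∧ 8 * n - (m - p) ≠ 0)
    (u : ℤ → ℝ) (hu : ∀ p ∈ S, 0 < u p) {Γ : ℝ}
    (hΓ : ∀ r ∈ Finset.Icc (0 : ℤ) 3,
      ∑ p ∈ S.filter (fun p => p % 4 = r), u p * ∑ m ∈ W, ‖fourierCoeff g₀ (m - p)‖ ^ 2 ≤ Γ)
    {t s : ℝ} (ht : 0 < t) (hs : 0 < s) :
    ∑ m ∈ W, ‖mFourierCoeff (θ ∘ shearMap 1 0 ψ) ![m, n]‖ ^ 2 ≤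
      (1 + t) * (Γ * ∑ p ∈ S, ‖mFourierCoeff θ ![p, n]‖ ^ 2 / u p) +
        (1 + 1 / t) * ((1 + s) * ∑' p : ℤ, (if p ∈ S then 0 else ‖mFourierCoeff θ ![p, n]‖ ^ 2) +
          (1 + 1 / s) * ((2 * π * η) ^ 2 * ∑ p ∈ S, ‖mFourierCoeff θ ![p, n]‖ ^ 2)) := by
  classical
  have hπ : 0 < π := Real.pi_pos
  have hη0 : 0 ≤ η := (abs_nonneg _).trans (hη 0)
  set c : ℤ → ℂ := fun p => mFourierCoeff θ ![p, n] with hc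
  have hcs : Summable fun p : ℤ => ‖c p‖ := by
    have hinj : Function.Injective (fun p : ℤ => (![p, n] : Fin 2 → ℤ)) := fun a b h => by
      have := congrFun h 0; simpa using this
    exact hsum.comp_injective hinj
  set g := twist ψ n with hg
  have hgc : Continuous g := continuous_twist ψ n
  have hg1 : ∀ x, ‖g x‖ ≤ 1 := fun x => (norm_twist ψ n x).le
  -- the fibre as a convolution, split at `S`
  have hconv : ∀ m, mFourierCoeff (θ ∘ shearMap 1 0 ψ) ![m, n] = ∑' p, c p * fourierCoeff g (m - p) := fun m =>
    mFourierCoeff_vstep_fibre hθ hsum ψ n m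
  set cR : ℤ → ℂ := fun p => if p ∈ S then 0 else c p with hcR
  have hcRs : Summable fun p => ‖cR p‖ := by
    refine Summable.of_nonneg_of_le (fun p => norm_nonneg _) (fun p => ?_) hcs
    by_cases hp : p ∈ S <;> simp [hcR, hp]
  have hsc : ∀ m, Summable fun p => c p * fourierCoeff g (m - p) := fun m => by
    refine Summable.of_norm_bounded hcs fun p => ?_
    rw [norm_mul]
    exact mul_le_of_le_one_right (norm_nonneg _) (norm_fourierCoeff_le_one hgc hg1 _)
  have hsplit : ∀ m, ∑' p, c p * fourierCoeff g (m - p) =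
      ∑ p ∈ S, c p * fourierCoeff g (m - p) + ∑' p, cR p * fourierCoeff g (m - p) := by
    intro m
    rw [tsum_eq_sum_add_tsum_compl (hsc m) S]
    congr 1
    refine tsum_congr fun p => ?_
    by_cases hp : p ∈ S <;> simp [hcR, hp]
  -- (1) `ℓ²(W)` triangle: finite part + remainder
  have htri := sqrt_sum_sq_le_sqrt_add_sqrt W (fun m => ∑' p, c p * fourierCoeff g (m - p))
    (fun m => ∑ p ∈ S, c p * fourierCoeff g (m - p))
  have hdiff : ∀ m, ∑' p, c p * fourierCoeff g (m - p) - ∑ p ∈ S, c p * fourierCoeff g (m - p) =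
      ∑' p, cR p * fourierCoeff g (m - p) := fun m => by rw [hsplit m]; ring
  simp only [hdiff] at htri
  have hR : Real.sqrt (∑ m ∈ W, ‖∑' p, cR p * fourierCoeff g (m - p)‖ ^ 2) ≤
      Real.sqrt (∑' p, (if p ∈ S then 0 else ‖c p‖ ^ 2)) := by
    refine Real.sqrt_le_sqrt ((sum_window_sq_norm_tsum_conv_le hgc hg1 hcRs W).trans (le_of_eq (tsum_congr fun p => ?_)))
    by_cases hp : p ∈ S <;> simp [hcR, hp]
  -- (2) rounding transfer to the exact chirp on the finite part
  have hg₀' : ∀ t : ℝ, g₀ (t : UnitAddCircle) =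
      cexp (-(2 * π * I * ((((8 * n : ℤ) : ℝ) * (tri (2 * π * (2 : ℕ) * t) / (2 * π * (2 : ℕ))) : ℝ) : ℂ))) := by
    intro t; rw [hg₀ t]; push_cast; ring_nf
  have hround := sqrt_window_sq_twist_le ψ n hg₀' hg₀c hη c S W
  -- (3) classes + Minkowski + weighted Cauchy–Schwarz on the exact part
  set F : ℝ := ∑ p ∈ S, ‖c p‖ ^ 2 / u p with hF
  have hF0 : 0 ≤ F := Finset.sum_nonneg fun p hp => div_nonneg (sq_nonneg _) (hu p hp).le
  have hΓ0 : 0 ≤ Γ := by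
    have h := hΓ 0 (by rw [Finset.mem_Icc]; omega)
    exact le_trans (Finset.sum_nonneg fun p hp => mul_nonneg (hu p (Finset.mem_filter.1 hp).1).le
      (Finset.sum_nonneg fun _ _ => sq_nonneg _)) h
  have hexact : ∑ m ∈ W, ‖∑ p ∈ S, c p * fourierCoeff g₀ (m - p)‖ ^ 2 ≤ Γ * F := by
    rw [sum_window_sq_conv_eq_sum_classes n hg₀ c S W hWS]
    have hcls : ∀ r ∈ Finset.Icc (0 : ℤ) 3,
        ∑ m ∈ W, ‖∑ p ∈ S.filter (fun p => p % 4 = r), c p * fourierCoeff g₀ (m - p)‖ ^ 2 ≤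
          Γ * ∑ p ∈ S.filter (fun p => p % 4 = r), ‖c p‖ ^ 2 / u p := by
      intro r hr
      set Sr := S.filter (fun p => p % 4 = r) with hSr
      have hM := sq_sum_norm_sum_le Sr W (fun p m => c p * fourierCoeff g₀ (m - p))
      have e : ∀ p, Real.sqrt (∑ m ∈ W, ‖c p * fourierCoeff g₀ (m - p)‖ ^ 2) =
          ‖c p‖ * Real.sqrt (∑ m ∈ W, ‖fourierCoeff g₀ (m - p)‖ ^ 2) := by
        intro p
        have e1 : ∑ m ∈ W, ‖c p * fourierCoeff g₀ (m - p)‖ ^ 2 = ‖c p‖ ^ 2 * ∑ m ∈ W, ‖fourierCoeff g₀ (m - p)‖ ^ 2 := by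
          rw [Finset.mul_sum]; exact Finset.sum_congr rfl fun m _ => by rw [norm_mul, mul_pow]
        rw [e1, Real.sqrt_mul (sq_nonneg _), Real.sqrt_sq (norm_nonneg _)]
      simp only [e] at hM
      have huSr : ∀ p ∈ Sr, 0 < u p := fun p hp => hu p (Finset.mem_filter.1 hp).1
      have hCS := sq_sum_mul_le_weighted Sr (fun p => ‖c p‖)
        (fun p => Real.sqrt (∑ m ∈ W, ‖fourierCoeff g₀ (m - p)‖ ^ 2)) u huSr
      have e2 : ∀ p, Real.sqrt (∑ m ∈ W, ‖fourierCoeff g₀ (m - p)‖ ^ 2) ^ 2 = ∑ m ∈ W, ‖fourierCoeff g₀ (m - p)‖ ^ 2 :=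
        fun p => Real.sq_sqrt (Finset.sum_nonneg fun _ _ => sq_nonneg _)
      simp only [e2] at hCS
      have hFr0 : 0 ≤ ∑ p ∈ Sr, ‖c p‖ ^ 2 / u p := Finset.sum_nonneg fun p hp => div_nonneg (sq_nonneg _) (huSr p hp).le
      calc ∑ m ∈ W, ‖∑ p ∈ Sr, c p * fourierCoeff g₀ (m - p)‖ ^ 2
          ≤ (∑ p ∈ Sr, ‖c p‖ * Real.sqrt (∑ m ∈ W, ‖fourierCoeff g₀ (m - p)‖ ^ 2)) ^ 2 := hM
        _ ≤ (∑ p ∈ Sr, ‖c p‖ ^ 2 / u p) * (∑ p ∈ Sr, u p * ∑ m ∈ W, ‖fourierCoeff g₀ (m - p)‖ ^ 2) := hCS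
        _ ≤ (∑ p ∈ Sr, ‖c p‖ ^ 2 / u p) * Γ := mul_le_mul_of_nonneg_left (hΓ r hr) hFr0
        _ = Γ * ∑ p ∈ Sr, ‖c p‖ ^ 2 / u p := mul_comm _ _
    calc ∑ r ∈ Finset.Icc (0 : ℤ) 3, ∑ m ∈ W, ‖∑ p ∈ S.filter (fun p => p % 4 = r), c p * fourierCoeff g₀ (m - p)‖ ^ 2
        ≤ ∑ r ∈ Finset.Icc (0 : ℤ) 3, Γ * ∑ p ∈ S.filter (fun p => p % 4 = r), ‖c p‖ ^ 2 / u p := Finset.sum_le_sum hcls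
      _ = Γ * F := by rw [← Finset.mul_sum, sum_classes_eq_sum S (fun p => ‖c p‖ ^ 2 / u p)]
  -- (4) assemble: `√X ≤ √(ΓF) + 2πη√E_S + √R`
  set X : ℝ := ∑ m ∈ W, ‖mFourierCoeff (θ ∘ shearMap 1 0 ψ) ![m, n]‖ ^ 2 with hX
  set ES : ℝ := ∑ p ∈ S, ‖c p‖ ^ 2 with hES
  set R : ℝ := ∑' p, (if p ∈ S then 0 else ‖c p‖ ^ 2) with hRdef
  have hES0 : 0 ≤ ES := Finset.sum_nonneg fun _ _ => sq_nonneg _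
  have hR0 : 0 ≤ R := tsum_nonneg fun p => by split_ifs <;> positivity
  have hXconv : X = ∑ m ∈ W, ‖∑' p, c p * fourierCoeff g (m - p)‖ ^ 2 := by
    simp only [hX, hconv]
  have hsqX : Real.sqrt X ≤ Real.sqrt (Γ * F) + 2 * π * η * Real.sqrt ES + Real.sqrt R := by
    rw [hXconv]
    refine htri.trans ?_
    have h1 : Real.sqrt (∑ m ∈ W, ‖∑ p ∈ S, c p * fourierCoeff g (m - p)‖ ^ 2) ≤
        Real.sqrt (Γ * F) + 2 * π * η * Real.sqrt ES :=
      hround.trans (add_le_add (Real.sqrt_le_sqrt hexact) le_rfl)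
    linarith
  -- square: `X ≤ (1+t)ΓF + (1+1/t)(2πη√ES + √R)²`, then Peter–Paul once more
  have hA0 : 0 ≤ Real.sqrt (Γ * F) := Real.sqrt_nonneg _
  have hB0 : 0 ≤ 2 * π * η * Real.sqrt ES + Real.sqrt R := by positivity
  have hX0 : 0 ≤ X := Finset.sum_nonneg fun _ _ => sq_nonneg _
  have h1 : X ≤ (Real.sqrt (Γ * F) + (2 * π * η * Real.sqrt ES + Real.sqrt R)) ^ 2 := by
    calc X = Real.sqrt X ^ 2 := (Real.sq_sqrt hX0).symm
      _ ≤ _ := pow_le_pow_left₀ (Real.sqrt_nonneg _) (by linarith) 2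
  have h2 := add_sq_le_peterPaul (Real.sqrt (Γ * F)) (2 * π * η * Real.sqrt ES + Real.sqrt R) ht
  rw [Real.sq_sqrt (mul_nonneg hΓ0 hF0)] at h2
  have h3 := add_sq_le_peterPaul (Real.sqrt R) (2 * π * η * Real.sqrt ES) hs
  rw [Real.sq_sqrt hR0, mul_pow, Real.sq_sqrt hES0] at h3
  have h4 : (2 * π * η * Real.sqrt ES + Real.sqrt R) ^ 2 ≤ (1 + s) * R + (1 + 1 / s) * ((2 * π * η) ^ 2 * ES) := by
    rw [add_comm]; exact h3
  have ht' : 0 ≤ 1 + 1 / t := by positivity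
  calc X ≤ (Real.sqrt (Γ * F) + (2 * π * η * Real.sqrt ES + Real.sqrt R)) ^ 2 := h1
    _ ≤ (1 + t) * (Γ * F) + (1 + 1 / t) * (2 * π * η * Real.sqrt ES + Real.sqrt R) ^ 2 := h2
    _ ≤ (1 + t) * (Γ * F) + (1 + 1 / t) * ((1 + s) * R + (1 + 1 / s) * ((2 * π * η) ^ 2 * ES)) :=
        add_le_add le_rfl (mul_le_mul_of_nonneg_left h4 ht')

end Summit.AnomalousDissipation.AnomalousDissipation.Theorems.SawtoothPulseCascade.K1Window
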